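/-
Copyright: cell pub-balaban-gaps (YM BLITZ Y1, track G1), seat g1-p2 GEN 10 (unit `pub-balaban-gaps-g1-p2`).  Row (D4) NODE O,
OBJECT ∕ MECHANISM level, CARRIER-GENERIC: PER-CUBE GAUGES AT THE LOCAL-INVERSE LEVEL — the mechanism of [B9] Cor. 3.6 ∕ p. 409
(*"This theorem follows simply from Corollary 3.6 holding for all G′_□"*): the local inverse `G′_□(U) = extend((compress A(U) □̃)⁻¹)` of a
gauge-COVARIANT operator family (`A(U) = fibD g⁻·A(U^g)·fibD g` for every site gauge `g`) is the CONJUGATE of the local inverse at the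
gauge-transformed field, `G′_□(U) = fibD g⁻·G′_□(U^g)·fibD g`, for every fibre-saturated `□̃` and EVERY gauge — so each cube may be
treated in ITS OWN gauge `u_□` (print's (3.35): «there exists a gauge transformation u on □ such that U^u = e^{iηA}, A small on □»), and
the block letters of `G′_□(U)` are those of the small-field local inverse times the gauge's row-sum factors `rr′`.  HONEST FRAMING:
elementary matrix algebra (compression ∕ extension commute with site-diagonal conjugation); nothing of Bałaban's constructed; the
per-cube gauges are hypothesis data (lit-balaban's `Reg335` supplies them per cube); (D4) instance 0∕1; NOT BetaPertH, NOT continuum, NOT Clay.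
-/
import Summits.QuantumFields.BalabanUV.Gaps.D4WalkBlockGaugeAlgebra
import Summits.QuantumFields.BalabanUV.Gaps.D4WalkBlockConjugate
import Summits.QuantumFields.BalabanUV.Beta.UnitLatticeLocalInverse

/-!
# `Gaps.D4WalkBlockLocalInverseGauge` — local inverses in per-cube gauges: compression ∕ extension commute with site gauges,
# `G′_□(U) = fibD g⁻·G′_□(U^g)·fibD g`, block letters `× rr′` (carrier-generic; cell pub-balaban-gaps, seat g1-p2 gen 10)

HONEST DEPENDENCY (cell pub-balaban, verbatim): continuum YM on T⁴ ⇐ BetaPertH ∧ nine spine estimates (0/9 proved);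
BetaPertH ⇐ (D1) ∧ (D4) ∧ CAP+tail.

Carrier `X × F` (sites × fibre), `fibD g` the site-diagonal action of a gauge (71 ∕ 91a), `compress`, `extend` of
`Beta.UnitLatticeLocalInverse` (GEN 5's parametrix junction `D4WalkBlockLocalInverse` builds `G′_□ = extend((compress A □̃)⁻¹)` from them).
The standing hypothesis `hS : ∀ p ∈ S, ∀ b, (p.1, b) ∈ S` says `S ⊆ X × F` is FIBRE-SATURATED (a union of whole fibres) — every cube `□̃ × F` is.
* §1 `compress_fibD_mul`, `compress_mul_fibD` (compression passes a site-diagonal factor on a fibre-saturated `S`),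
  `compress_fibD_mul_compress_fibD` (`compress(fibD g)·compress(fibD g⁻) = 1`), **`compress_conj`**, `compress_extend`, `eq_extend_compress`
  (a matrix supported in `S × S` is the extension of its compression), **`extend_conj`** (`fibD g⁻·extend N·fibD g = extend(compress(fibD g⁻)·N·compress(fibD g))`).
* §2 **`locInv_conj`**: `extend((compress (fibD g⁻·M·fibD g) S)⁻¹) = fibD g⁻·extend((compress M S)⁻¹)·fibD g` — the local inverse of a
  covariant family at `U` is the conjugate of the local inverse at `U^g`, for EVERY gauge (hence a different one per cube);
  `isUnit_det_compress_conj_iff` (invertibility of the compression is gauge-invariant); **`blockNorm_locInv_conj_le`** (block letters of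
  `G′_□(U)` ≤ `rr′ ×` those of `G′_□(U^g)`, 90's row bounds).
WHAT IT IS NOT.  The instance on [4]'s nested family with lit-balaban's `Reg335` cube family (the per-cube small-field letters of
`G′_□(e^{iηA_□})` come from the one-cube Neumann series ∕ Cor. 3.5 chain; feeding them into GEN 5's `blockWalkExpansion_parametrix_lipschitz`
is the remaining (L) step); (D4) instance 0∕1; words of row (D4) UNCHANGED.

References: T. Bałaban, Comm. Math. Phys. **99** (1985) 389–434 [B9], (3.35) p. 396, p. 398, Cor. 3.6 p. 408, p. 409, (3.65)′–(3.66) p. 403.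
-/

noncomputable section

namespace Summit.QuantumFields.BalabanUV.Gaps.D4WalkBlockLocalInverseGauge

open scoped Matrix
open Literature.MathematicalPhysics.QuantumFieldTheory.Balaban1983to89
open Literature.MathematicalPhysics.QuantumFieldTheory.Balaban1983to89.B5TorusCover (UT)
open Summit.QuantumFields.BalabanUV.Beta.UnitLatticeLocalInverse (compress extend extend_apply_of_mem extend_apply_of_not_mem_left
  extend_apply_of_not_mem_right)
open Summit.QuantumFields.BalabanUV.Gaps.D4WalkBlock (blockNorm blockNorm_nonneg)
open Summit.QuantumFields.BalabanUV.Gaps.D4WalkBlockConjugate (blockNorm_local_mul_le blockNorm_mul_local_le)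
open Summit.QuantumFields.BalabanUV.Gaps.D4WalkBlockShiftAlgebra (fibD fibD_local)
open Summit.QuantumFields.BalabanUV.Gaps.D4WalkBlockGaugeAlgebra (fibD_mul_fibD_eq_one conj_inv_eq rowSum_fibD)

variable {X : Type} {F : Type} [Fintype X] [Fintype F] [DecidableEq X] [DecidableEq F]

/-! ## §1. Compression and extension commute with site-diagonal conjugation -/

section Algebra

variable {S : Finset (X × F)} (hS : ∀ p ∈ S, ∀ b : F, (p.1, b) ∈ S)
include hS

omit [Fintype X] [Fintype F] [DecidableEq X] [DecidableEq F] in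
/-- outside a fibre-saturated set, the whole fibre is outside. -/
theorem not_mem_of_not_mem {p : X × F} (hp : p ∉ S) (b : F) : (p.1, b) ∉ S :=
  fun h => hp (by simpa using hS (p.1, b) h p.2)

omit [Fintype X] [Fintype F] [DecidableEq X] [DecidableEq F] in
/-- two sites of the same fibre are in `S` together. -/
theorem mem_of_fst_eq {p r : X × F} (hr : r ∈ S) (h : p.1 = r.1) : p ∈ S := by
  have := hS r hr p.2
  rw [← h] at this
  simpa using this

omit [DecidableEq F] in
/-- **compression passes a LEFT site-diagonal factor**: `compress (fibD g·M) S = compress (fibD g) S · compress M S`. -/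
theorem compress_fibD_mul (g : X → Matrix F F ℂ) (M : Matrix (X × F) (X × F) ℂ) :
    compress (fibD X F g * M) S = compress (fibD X F g) S * compress M S := by
  ext i j
  simp only [compress, Matrix.submatrix_apply, Matrix.mul_apply]
  rw [Finset.sum_coe_sort S (fun r => fibD X F g i.1 r * M r j.1)]
  refine (Finset.sum_subset (Finset.subset_univ S) fun r _ hr => ?_).symm
  have : fibD X F g i.1 r = 0 := by
    by_contra hne
    exact hr (mem_of_fst_eq hS i.2 (fibD_local (fun x : X => x) g i.1 r hne).symm)
  rw [this, zero_mul]

omit [DecidableEq F] in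
/-- **compression passes a RIGHT site-diagonal factor**: `compress (M·fibD g) S = compress M S · compress (fibD g) S`. -/
theorem compress_mul_fibD (g : X → Matrix F F ℂ) (M : Matrix (X × F) (X × F) ℂ) :
    compress (M * fibD X F g) S = compress M S * compress (fibD X F g) S := by
  ext i j
  simp only [compress, Matrix.submatrix_apply, Matrix.mul_apply]
  rw [Finset.sum_coe_sort S (fun r => M i.1 r * fibD X F g r j.1)]
  refine (Finset.sum_subset (Finset.subset_univ S) fun r _ hr => ?_).symm
  have : fibD X F g r j.1 = 0 := by
    by_contra hne
    exact hr (mem_of_fst_eq hS j.2 (fibD_local (fun x : X => x) g r j.1 hne))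
  rw [this, mul_zero]

/-- `compress (fibD g) S · compress (fibD g⁻) S = 1` for a sitewise inverse pair. -/
theorem compress_fibD_mul_compress_fibD {g gi : X → Matrix F F ℂ} (hg : ∀ x, g x * gi x = 1) :
    compress (fibD X F g) S * compress (fibD X F gi) S = 1 := by
  rw [← compress_fibD_mul hS, fibD_mul_fibD_eq_one hg]
  ext i j
  simp only [compress, Matrix.submatrix_apply, Matrix.one_apply, Subtype.ext_iff]

omit [DecidableEq F] in
/-- **`compress (fibD g⁻·M·fibD g) S = compress (fibD g⁻) S · compress M S · compress (fibD g) S`**. -/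
theorem compress_conj (g gi : X → Matrix F F ℂ) (M : Matrix (X × F) (X × F) ℂ) :
    compress (fibD X F gi * M * fibD X F g) S = compress (fibD X F gi) S * compress M S * compress (fibD X F g) S := by
  rw [compress_mul_fibD hS, compress_fibD_mul hS]

omit hS in
omit [Fintype X] [Fintype F] in
/-- compression undoes extension. -/
theorem compress_extend (N : Matrix S S ℂ) : compress (extend N) S = N := by
  ext i j
  simp only [compress, Matrix.submatrix_apply]
  rw [extend_apply_of_mem _ i.2 j.2]

omit hS in
omit [Fintype X] [Fintype F] in
/-- a matrix supported in `S × S` is the extension of its compression. -/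
theorem eq_extend_compress {A : Matrix (X × F) (X × F) ℂ} (hrow : ∀ p, p ∉ S → ∀ q, A p q = 0)
    (hcol : ∀ q, q ∉ S → ∀ p, A p q = 0) : A = extend (compress A S) := by
  ext p q
  by_cases hp : p ∈ S
  · by_cases hq : q ∈ S
    · rw [extend_apply_of_mem _ hp hq]; rfl
    · rw [extend_apply_of_not_mem_right _ p hq, hcol q hq p]
  · rw [extend_apply_of_not_mem_left _ hp, hrow p hp q]

/-- **`fibD g⁻·extend N·fibD g = extend (compress (fibD g⁻) S · N · compress (fibD g) S)`**: extension by zero passes site gauges. -/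
theorem extend_conj (g gi : X → Matrix F F ℂ) (N : Matrix S S ℂ) :
    fibD X F gi * extend N * fibD X F g = extend (compress (fibD X F gi) S * N * compress (fibD X F g) S) := by
  have hrow : ∀ p, p ∉ S → ∀ q, (fibD X F gi * extend N * fibD X F g) p q = 0 := by
    intro p hp q
    rw [Matrix.mul_apply]
    refine Finset.sum_eq_zero fun s _ => ?_
    rw [Matrix.mul_apply, Finset.sum_eq_zero fun r _ => ?_, zero_mul]
    by_cases hr : r ∈ S
    · have : fibD X F gi p r = 0 := by
        by_contra hne
        exact hp (mem_of_fst_eq hS hr (fibD_local (fun x : X => x) gi p r hne))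
      rw [this, zero_mul]
    · rw [extend_apply_of_not_mem_left _ hr, mul_zero]
  have hcol : ∀ q, q ∉ S → ∀ p, (fibD X F gi * extend N * fibD X F g) p q = 0 := by
    intro q hq p
    rw [Matrix.mul_apply]
    refine Finset.sum_eq_zero fun s _ => ?_
    by_cases hs : s ∈ S
    · have : fibD X F g s q = 0 := by
        by_contra hne
        exact hq (mem_of_fst_eq hS hs (fibD_local (fun x : X => x) g s q hne).symm)
      rw [this, mul_zero]
    · rw [Matrix.mul_apply, Finset.sum_eq_zero fun r _ => by rw [extend_apply_of_not_mem_right _ r hs, mul_zero], zero_mul]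
  calc fibD X F gi * extend N * fibD X F g = extend (compress (fibD X F gi * extend N * fibD X F g) S) :=
        eq_extend_compress hrow hcol
    _ = _ := by rw [compress_conj hS, compress_extend]

end Algebra

/-! ## §2. The local inverse in a per-cube gauge -/

section LocalInverse

variable {S : Finset (X × F)} (hS : ∀ p ∈ S, ∀ b : F, (p.1, b) ∈ S) {g gi : X → Matrix F F ℂ}
include hS

/-- **THE LOCAL INVERSE OF A COVARIANT FAMILY IS THE CONJUGATE OF THE LOCAL INVERSE AT THE GAUGE-TRANSFORMED FIELD**: for a
fibre-saturated `S` (an enlarged cube `□̃ × F`) and a site gauge with two-sided inverse,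
`extend((compress (fibD g⁻·M·fibD g) S)⁻¹) = fibD g⁻·extend((compress M S)⁻¹)·fibD g`.  With `M = A(U^{u_□})` (small field on `□̃`)
and `A(U) = fibD u_□⁻·A(U^{u_□})·fibD u_□` (gauge covariance, 91a ∕ 91b), this is `G′_□(U) = u_□⁻¹G′_□(U^{u_□})u_□` — one gauge PER CUBE.
[cite: Balaban1985BackgroundPropagators, (3.35) p.396, p.398, Cor. 3.6 p.408, p.409] -/
theorem locInv_conj (hg : ∀ x, g x * gi x = 1) (hgi : ∀ x, gi x * g x = 1) (M : Matrix (X × F) (X × F) ℂ) :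
    extend ((compress (fibD X F gi * M * fibD X F g) S)⁻¹) = fibD X F gi * extend ((compress M S)⁻¹) * fibD X F g := by
  rw [compress_conj hS, conj_inv_eq _ _ _ (compress_fibD_mul_compress_fibD hS hgi) (compress_fibD_mul_compress_fibD hS hg),
    extend_conj hS]

/-- invertibility of the compression is gauge-invariant. -/
theorem isUnit_det_compress_conj_iff (hg : ∀ x, g x * gi x = 1) (hgi : ∀ x, gi x * g x = 1) (M : Matrix (X × F) (X × F) ℂ) :
    IsUnit (compress (fibD X F gi * M * fibD X F g) S).det ↔ IsUnit (compress M S).det := by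
  rw [compress_conj hS, Matrix.det_mul, Matrix.det_mul, IsUnit.mul_iff, IsUnit.mul_iff]
  have hA : IsUnit (compress (fibD X F gi) S).det := Matrix.isUnit_det_of_right_inverse (compress_fibD_mul_compress_fibD hS hgi)
  have hB : IsUnit (compress (fibD X F g) S).det := Matrix.isUnit_det_of_right_inverse (compress_fibD_mul_compress_fibD hS hg)
  exact ⟨fun h => h.1.2, fun h => ⟨⟨hA, h⟩, hB⟩⟩

variable {ν : ℕ} {Kv : Fin ν → ℕ}

/-- **BLOCK LETTERS OF THE LOCAL INVERSE IN A PER-CUBE GAUGE**: with cube map `cub` (any), gauge row sums `Σ_b‖g⁻(x)_{ab}‖ ≤ r`,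
`Σ_b‖g(x)_{ab}‖ ≤ r′`: `‖G′_□(U)‖_{Y,Y′} ≤ rr′·‖G′_□(U^g)‖_{Y,Y′}` for every pair of cubes — print's unitary `u_□` costs nothing
(`r = r′ = 1` in the `ℓ^∞`-operator-norm model with «row sums ≤ 1», 96's reading of `‖u‖, ‖u⁻¹‖ ≤ 1`).
[cite: Balaban1985BackgroundPropagators, (3.35) p.396, Cor. 3.6 p.408, p.409] -/
theorem blockNorm_locInv_conj_le (cub : X → UT Kv) (hg : ∀ x, g x * gi x = 1) (hgi : ∀ x, gi x * g x = 1) {r r' : ℝ} (hr0 : 0 ≤ r)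
    (hr0' : 0 ≤ r') (hr : ∀ x a, ∑ b, ‖gi x a b‖ ≤ r) (hr' : ∀ x a, ∑ b, ‖g x a b‖ ≤ r') (M : Matrix (X × F) (X × F) ℂ)
    (Y Y' : UT Kv) :
    blockNorm (fun p : X × F => cub p.1) (fun p : X × F => cub p.1) (extend ((compress (fibD X F gi * M * fibD X F g) S)⁻¹)) Y Y' ≤
      r * r' * blockNorm (fun p : X × F => cub p.1) (fun p : X × F => cub p.1) (extend ((compress M S)⁻¹)) Y Y' := by
  rw [locInv_conj hS hg hgi]
  have hloc : ∀ (h : X → Matrix F F ℂ) (i j : X × F),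
      (fun p : X × F => cub p.1) i ≠ (fun p : X × F => cub p.1) j → fibD X F h i j = 0 :=
    fun h i j hij => by_contra fun hne => hij (fibD_local cub h i j hne)
  have hrow_gi : ∀ i : X × F, ∑ j, ‖fibD X F gi i j‖ ≤ r := fun i => by rw [rowSum_fibD]; exact hr i.1 i.2
  have hrow_g : ∀ i : X × F, ∑ j, ‖fibD X F g i j‖ ≤ r' := fun i => by rw [rowSum_fibD]; exact hr' i.1 i.2
  rw [Matrix.mul_assoc]
  calc _ ≤ r * blockNorm _ _ (extend ((compress M S)⁻¹) * fibD X F g) Y Y' :=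
        blockNorm_local_mul_le _ _ _ (hloc gi) hr0 hrow_gi _ Y Y'
    _ ≤ r * (blockNorm _ _ (extend ((compress M S)⁻¹)) Y Y' * r') :=
        mul_le_mul_of_nonneg_left (blockNorm_mul_local_le _ _ _ _ (hloc g) hr0' hrow_g Y Y') hr0
    _ = _ := by ring

end LocalInverse

end Summit.QuantumFields.BalabanUV.Gaps.D4WalkBlockLocalInverseGauge

end
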